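import Mathlib.MeasureTheory.Constructions.Cylinders
import Mathlib.MeasureTheory.Integral.Bochner.Basic
import Mathlib.MeasureTheory.Integral.Bochner.ContinuousLinearMap
import Mathlib.Analysis.Complex.Basic
import Mathlib.Data.ZMod.Basic
import Literature.Probability.LatticeModels.LatticeGraph
import HarnessLib

-- provenance: harness21/H21/H21/Prelude/StatMech/ReflectionPositivity.lean @ 42c9a31 (interim HEAD d8f2665); M5 mechanical rewrite
/-!
# Reflection positivity (StatMech trunk, prelude P19 / design D6)

This file sets up the vocabulary of *reflection positivity* (RP) for lattice measures and for
abstract (quantum) functionals.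

* **Classical / lattice measures.** For a reflection `θ : V ≃ V` of the vertex set, the induced
  map on configurations `configReflect θ : (V → S) ≃ (V → S)`, `σ ↦ σ ∘ θ`; it is measurable
  (`measurable_configReflect`), so `Measure.map (configReflect θ)` carries no junk value.
  The "positive half" σ-algebra is Mathlib's `MeasureTheory.cylinderEvents V₊`
  (abbreviated `positiveEvents V₊`). A measure `μ` is *reflection positive* w.r.t. `(θ, V₊)` if
  `0 ≤ Re ∫ conj (F (θσ)) F(σ) dμ` for every bounded `positiveEvents V₊`-measurable `F`
  (`IsReflectionPositive`); a real-valued variant `IsReflectionPositiveReal` and the RP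
  Cauchy–Schwarz inequality `rp_cauchySchwarz` are stated.
* **Torus reflections.** On `TorusSite d L = Fin d → ZMod L`, the reflections through sites
  (`x_i ↦ 2k - x_i`) and between sites (`x_i ↦ 2k + 1 - x_i`) as `Equiv`s, with involutivity
  (real proofs) and the corresponding half-tori. These are only geometrically meaningful for even
  `L`; following the outline (R9), `Even L` appears as an explicit hypothesis in statements.
* **Abstract / quantum (Dyson–Lieb–Simon).** `IsReflectionPositiveFunctional φ θ A₊` for a linear
  functional on a `ℂ`-algebra: `φ (θ a * a) ≥ 0` for all `a` in the positive subalgebra `A₊`.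

Chessboard estimates and Gaussian domination are **not** itemised here (outline R5).

Mathlib search: Mathlib has `MeasureTheory.cylinderEvents` (used), `Equiv.arrowCongr`
(our `configReflect` is the specialisation with pointwise formula `σ (θ x)`), but no notion of
reflection positivity.

References: J. Fröhlich, R. Israel, E. H. Lieb, B. Simon, *Phase transitions and reflection
positivity I*, Comm. Math. Phys. 62 (1978), §2; M. Biskup, *Reflection positivity and phase
transitions in lattice spin models*, LNM 1970 (2009), §5; F. J. Dyson, E. H. Lieb, B. Simon,
J. Stat. Phys. 18 (1978).
-/

open MeasureTheory

namespace Literature.Probability.LatticeModels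

/-! ### Reflections of configurations -/

section Config

variable {V S : Type*}

/-- The map on configurations induced by a bijection `θ` of the vertex set:
`configReflect θ σ = σ ∘ θ`. When `θ` is an involution (a lattice reflection) this is the
reflection of configurations of FILS 1978 §2 / Biskup 2009 §5.1. [cite: FILS1978, §2 / Biskup 2009 §5.1] -/
def configReflect (θ : V ≃ V) : (V → S) ≃ (V → S) where
  toFun σ := σ ∘ θ
  invFun σ := σ ∘ θ.symm
  left_inv σ := by ext x; simp
  right_inv σ := by ext x; simp

/-- Pointwise formula: `configReflect θ σ x = σ (θ x)` (Biskup 2009 §5.1, `(θσ)_x = σ_{θx}`). [cite: Biskup2009, §5.1   (θσ] -/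
@[simp]
theorem configReflect_apply (θ : V ≃ V) (σ' : V → S) (x : V) :
    configReflect θ σ' x = σ' (θ x) := rfl

/-- `configReflect θ` composed with itself along an involution is the identity
(Biskup 2009 §5.1: `θ² = id`). [cite: Biskup2009, §5.1:  θ² = id] -/
theorem configReflect_configReflect_of_involutive {θ : V ≃ V}
    (hθ : Function.Involutive θ) (σ' : V → S) :
    configReflect θ (configReflect θ σ') = σ' := by
  ext x; simp [hθ x]

variable [MeasurableSpace S]

/-- `configReflect θ` is measurable for the product σ-algebra (it is a coordinate permutation);
hence `Measure.map (configReflect θ)` has no junk value (FILS 1978 §2). [cite: FILS1978, §2] -/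
@[fun_prop]
theorem measurable_configReflect (θ : V ≃ V) :
    Measurable (configReflect (S := S) θ) :=
  measurable_pi_iff.mpr fun x => measurable_pi_apply (θ x)

/-- The σ-algebra of events depending only on the spins in the "positive half" `V₊`; this is
Mathlib's `MeasureTheory.cylinderEvents V₊` (Biskup 2009 §5.1, the algebra `𝔄₊`). [cite: Biskup2009, §5.1  the algebra  𝔄₊] -/
abbrev positiveEvents (Vpos : Set V) : MeasurableSpace (V → S) :=
  MeasureTheory.cylinderEvents (X := fun _ : V => S) Vpos

/-- A measure on configurations is *reflection invariant* under `θ` if its push-forward along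
`configReflect θ` is itself. Since `configReflect θ` is measurable (`measurable_configReflect`),
`Measure.map` carries no junk value here (FILS 1978 §2). [cite: FILS1978, §2] -/
def IsReflectionInvariant (μ : Measure (V → S)) (θ : V ≃ V) : Prop :=
  μ.map (configReflect θ) = μ

/-- **Reflection positivity** of a lattice measure (FILS 1978 §2, Def. before Thm. 2.1;
Biskup 2009 Def. 5.2): for every bounded complex observable `F` measurable with respect to the
positive-half σ-algebra `positiveEvents V₊`,
`0 ≤ Re ∫ conj (F (θ σ)) · F σ dμ(σ)`. [cite: FILS1978, §2  Def. before Thm. 2.1] -/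
def IsReflectionPositive (μ : Measure (V → S)) (θ : V ≃ V) (Vpos : Set V) : Prop :=
  ∀ F : (V → S) → ℂ, Measurable[positiveEvents Vpos] F → (∃ C, ∀ σ', ‖F σ'‖ ≤ C) →
    0 ≤ (∫ σ', starRingEnd ℂ (F (configReflect θ σ')) * F σ' ∂μ).re

/-- Real-valued reflection positivity: `0 ≤ ∫ F (θ σ) · F σ dμ(σ)` for every bounded real
observable `F` measurable w.r.t. `positiveEvents V₊` (Biskup 2009 Def. 5.2, real form). [cite: Biskup2009, Def. 5.2  real form] -/
def IsReflectionPositiveReal (μ : Measure (V → S)) (θ : V ≃ V) (Vpos : Set V) : Prop :=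
  ∀ F : (V → S) → ℝ, Measurable[positiveEvents Vpos] F → (∃ C, ∀ σ', ‖F σ'‖ ≤ C) →
    0 ≤ ∫ σ', F (configReflect θ σ') * F σ' ∂μ

/-- Complex reflection positivity implies the real-valued form (apply the definition to
`F : (V → S) → ℝ` viewed as complex-valued; Biskup 2009 remark after Def. 5.2). [cite: Biskup2009, remark after Def. 5.2] -/
theorem IsReflectionPositive.real {μ : Measure (V → S)} {θ : V ≃ V} {Vpos : Set V}
    (h : IsReflectionPositive μ θ Vpos) : IsReflectionPositiveReal μ θ Vpos := by
  intro F hF hFb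
  obtain ⟨C, hC⟩ := hFb
  have := h (fun σ' => (F σ' : ℂ)) (Complex.measurable_ofReal.comp hF)
    ⟨C, fun σ' => by simpa using hC σ'⟩
  rw [integral_congr_ae (g := fun σ' => ((F (configReflect θ σ') * F σ' : ℝ) : ℂ))
      (ae_of_all _ fun σ' => by simp), integral_complex_ofReal, Complex.ofReal_re] at this
  exact this

/-- The **Cauchy–Schwarz inequality of reflection positivity** (FILS 1978 Thm. 2.1 proof;
Biskup 2009 Lemma 5.3): if `μ` is reflection positive and reflection invariant then for bounded
`positiveEvents V₊`-measurable `F, G`,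
`|∫ conj (F ∘ θ) G dμ|² ≤ (Re ∫ conj (F ∘ θ) F dμ) (Re ∫ conj (G ∘ θ) G dμ)`. [cite: FILS1978, Thm. 2.1 proof] -/
def rp_cauchySchwarz : Prop :=
  ∀ {μ : Measure (V → S)} [IsFiniteMeasure μ] {θ : V ≃ V} {Vpos : Set V} (hθ : Function.Involutive θ) (hμ : IsReflectionPositive μ θ Vpos) (hinv : IsReflectionInvariant μ θ) (F G : (V → S) → ℂ) (hF : Measurable[positiveEvents Vpos] F) (hFb : ∃ C, ∀ σ', ‖F σ'‖ ≤ C) (hG : Measurable[positiveEvents Vpos] G) (hGb : ∃ C, ∀ σ', ‖G σ'‖ ≤ C),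
    ‖∫ σ', starRingEnd ℂ (F (configReflect θ σ')) * G σ' ∂μ‖ ^ 2 ≤
      (∫ σ', starRingEnd ℂ (F (configReflect θ σ')) * F σ' ∂μ).re *
        (∫ σ', starRingEnd ℂ (G (configReflect θ σ')) * G σ' ∂μ).re

end Config

/-! ### Reflections of the discrete torus -/

namespace Torus

variable {d L : ℕ}

/-- Reflection of the torus `TorusSite d L` *through sites* in the `i`-th coordinate direction,
through the hyperplanes `x_i = k` and `x_i = k + L/2`: `x_i ↦ 2k - x_i`, other coordinates
fixed (FILS 1978 §2; Biskup 2009 §5.1). [cite: FILS1978, §2] -/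
def reflectThroughSites (i : Fin d) (k : ZMod L) : TorusSite d L ≃ TorusSite d L where
  toFun x := Function.update x i (2 * k - x i)
  invFun x := Function.update x i (2 * k - x i)
  left_inv x := by ext j; by_cases h : j = i <;> simp [h]
  right_inv x := by ext j; by_cases h : j = i <;> simp [h]

/-- Reflection of the torus `TorusSite d L` *between sites* in the `i`-th coordinate direction,
through the hyperplane bisecting the bonds `{k, k+1}` (and `{k + L/2, k + L/2 + 1}`):
`x_i ↦ 2k + 1 - x_i`, other coordinates fixed (FILS 1978 §2; Biskup 2009 §5.1). [cite: FILS1978, §2] -/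
def reflectBetweenSites (i : Fin d) (k : ZMod L) : TorusSite d L ≃ TorusSite d L where
  toFun x := Function.update x i (2 * k + 1 - x i)
  invFun x := Function.update x i (2 * k + 1 - x i)
  left_inv x := by ext j; by_cases h : j = i <;> simp [h]
  right_inv x := by ext j; by_cases h : j = i <;> simp [h]

/-- Pointwise formula for the reflection through sites (Biskup 2009 §5.1). [cite: Biskup2009, §5.1] -/
@[simp]
theorem reflectThroughSites_apply (i : Fin d) (k : ZMod L) (x : TorusSite d L) :
    reflectThroughSites i k x = Function.update x i (2 * k - x i) := rfl

/-- Pointwise formula for the reflection between sites (Biskup 2009 §5.1). [cite: Biskup2009, §5.1] -/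
@[simp]
theorem reflectBetweenSites_apply (i : Fin d) (k : ZMod L) (x : TorusSite d L) :
    reflectBetweenSites i k x = Function.update x i (2 * k + 1 - x i) := rfl

/-- Reflections through sites are involutions (Biskup 2009 §5.1, `θ² = id`). [cite: Biskup2009, §5.1   θ² = id] -/
theorem reflectThroughSites_involutive (i : Fin d) (k : ZMod L) :
    Function.Involutive (reflectThroughSites (d := d) (L := L) i k) :=
  (reflectThroughSites i k).left_inv

/-- Reflections between sites are involutions (Biskup 2009 §5.1, `θ² = id`). [cite: Biskup2009, §5.1   θ² = id] -/
theorem reflectBetweenSites_involutive (i : Fin d) (k : ZMod L) :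
    Function.Involutive (reflectBetweenSites (d := d) (L := L) i k) :=
  (reflectBetweenSites i k).left_inv

variable [NeZero L]

/-- The positive half-torus for the reflection *through sites* `reflectThroughSites i k`:
the sites with `0 ≤ x_i - k ≤ L/2` (representatives in `{0, …, L-1}`), i.e. the slab between the
two fixed hyperplanes `x_i = k` and `x_i = k + L/2`, both included. Meaningful for even `L`
(Biskup 2009 §5.1, `𝕋_L^+`). [cite: Biskup2009, §5.1   𝕋_L^+] -/
def halfThroughSites (i : Fin d) (k : ZMod L) : Set (TorusSite d L) :=
  {x | (x i - k).val ≤ L / 2}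

/-- The positive half-torus for the reflection *between sites* `reflectBetweenSites i k`:
the sites with `1 ≤ x_i - k ≤ L/2` (representatives in `{0, …, L-1}`), i.e. the `L/2`
hyperplanes `x_i = k+1, …, k+L/2` on one side of the bisected bonds. Meaningful for even `L`
(Biskup 2009 §5.1, `𝕋_L^+`). [cite: Biskup2009, §5.1   𝕋_L^+] -/
def halfBetweenSites (i : Fin d) (k : ZMod L) : Set (TorusSite d L) :=
  {x | 1 ≤ (x i - k).val ∧ (x i - k).val ≤ L / 2}

/-- For even `L`, the reflection between sites maps the positive half-torus onto its complement
(Biskup 2009 §5.1: `θ(𝕋_L^+) = 𝕋_L^-`, the two halves partition the torus). [cite: Biskup2009, §5.1:  θ(𝕋_L^+] -/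
def reflect_maps_half_compl : Prop :=
  ∀ (hL : Even L) (i : Fin d) (k : ZMod L),
    reflectBetweenSites i k '' halfBetweenSites i k = (halfBetweenSites (d := d) i k)ᶜ

/-- For even `L`, the reflection through sites maps the positive half-torus onto the set of sites
on the other side, meeting it exactly in the two fixed hyperplanes `x_i = k`, `x_i = k + L/2`
(Biskup 2009 §5.1: `θ(𝕋_L^+) = 𝕋_L^-`, `𝕋_L^+ ∩ 𝕋_L^- = P`). [cite: Biskup2009, §5.1:  θ(𝕋_L^+] -/
def reflectThroughSites_image_half_inter : Prop :=
  ∀ (hL : Even L) (i : Fin d) (k : ZMod L),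
    reflectThroughSites i k '' halfThroughSites i k ∩ halfThroughSites (d := d) i k =
      {x | x i = k ∨ x i = k + (L / 2 : ℕ)}

end Torus

/-! ### Abstract (quantum) reflection positivity -/

section Abstract

variable {A : Type*} [Ring A] [Algebra ℂ A]

/-- **Abstract reflection positivity** of a linear functional (Dyson–Lieb–Simon 1978; FILS 1978
§2, "general framework"; Biskup 2009 Def. 5.2 in operator form): `φ` is reflection positive with
respect to the (anti)morphism `θ : A → A` and the "positive" subalgebra `A₊ ⊆ A` if
`φ (θ a * a)` is a nonnegative real number for every `a ∈ A₊`. Here `θ` is an arbitrary map; in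
applications it is an antilinear involutive (anti)automorphism with `θ '' A₊ = A₋`. [cite: DysonLiebSimon1978] -/
def IsReflectionPositiveFunctional (φ : A →ₗ[ℂ] ℂ) (θ : A → A) (Apos : Set A) : Prop :=
  ∀ a ∈ Apos, 0 ≤ (φ (θ a * a)).re ∧ (φ (θ a * a)).im = 0

end Abstract

end Literature.Probability.LatticeModels
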